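import Summits.NavierStokesRegularity.NavierStokesRegularity.Theorems.AdaptedFrequencyAdaptedFrequencyConvergesStubPinchingUpper
import Summits.NavierStokesRegularity.NavierStokesRegularity.Theorems.AdaptedFrequencyAdaptedFrequencyConvergesStubPinchingLower
import Summits.NavierStokesRegularity.NavierStokesRegularity.Theorems.AdaptedFrequencyAdaptedFrequencyConvergesStubKernelCalculus
import Summits.NavierStokesRegularity.NavierStokesRegularity.Theorems.AdaptedFrequencyEnstrophyDensity

/-! # Frequency ceiling — crux stmt-NavierStokesRegularity-10493
(`AdaptedFrequency.AdaptedFrequencyConverges`), line unsteadiness-squeeze, stub `stub_frequencyCeiling`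

PROVED: the registered stub `stub_frequencyCeiling` of line `unsteadiness-squeeze` — for a Type-I
classical Leray–Hopf solution `(u, p)` on `ℝ³ × [0, T)` from a rapidly decaying datum, singular at
`(T, x₀)`, and a Gaussian-comparable flow-adapted backward kernel `G` on `[t₀, T)`, the adapted
frequency `Λ(t) = (T − t) H′(t)/H(t)` of the adapted enstrophy `H(t) = ∫ ‖curl u(t)‖² G(t)` is
BOUNDED ABOVE on a left neighbourhood `[t₁, T)` of `T`.

Proof (everything rests on theorems of the tree; no named fact is assumed):
1. *floor* (`TauberianOmegaLimit.stub_pinchingLower`, landed): `0 < c₀ ≤ (T − t)² H(t)` on some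
   `[t₁, T)`, hence `H(t) > 0` there;
2. *Type-I gradient bound* (`TauberianOmegaLimit.pinchingUpper_fderiv_bound`, landed):
   `‖∇u(t, x)‖ ≤ K/(T − t)` on `[T/2, T) × ℝ³`;
3. *kernel calculus* (`TauberianOmegaLimit.kernelCalculus_hasDerivAt_adaptedEnstrophy_of_bounds`
   on the window `(t₀, (t + T)/2)`, with the bounds on `u, ∇u, ∇²u, ∇³u` on the closed slab
   `[0, (t + T)/2]` from Tao 2013, Cor. 11.1, `tao2011_hasBoundedSobolevNormsOn_holds`, and Sobolev
   imbedding, exactly as in the landed `stub_kernelCalculus`) and the enstrophy density identity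
   `(∂ₜ + u·∇ − νΔ)‖ω‖² = 2⟪ω, (∇u)ω⟫ − 2ν|∇ω|²_F` (`opL_norm_curl_sq_eq`):
   `H′(t) = ∫ (2⟪ω, (∇u)ω⟫ − 2ν|∇ω|²_F) G(t)` at every `t ∈ (t₀, T)`
   (`frequencyCeiling_hasDerivAt`);
4. dropping the dissipation, `H′(t) ≤ 2‖∇u(t)‖_∞ H(t) ≤ (2K/(T − t)) H(t)`, so
   `Λ(t) ≤ 2K` on `[max (t₁, T/2, (t₀ + T)/2), T)`.
-/

noncomputable section

open scoped Topology InnerProductSpace RealInnerProductSpace Laplacian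
open Literature.Analysis.FluidPDE Set Filter MeasureTheory

namespace Summit.NavierStokesRegularity.NavierStokesRegularity.Theorems.AdaptedFrequencyConverges.UnsteadinessSqueeze

open TauberianOmegaLimit

/-! ### Kernel calculus at every interior time, in the spatial form of the density -/

/-- **First variation of the adapted enstrophy at every `t ∈ (t₀, T)`, spatial form.** For a
classical solution on `ℝ³ × [0, T)`, Leray–Hopf from its rapidly decaying datum, and an adapted,
Gaussian-comparable backward kernel `G` on `[t₀, T)`,
`H′(t) = ∫ (2⟪ω, (∇u)ω⟫ − 2ν|∇ω|²_F) G(t)`, `ω = curl u(t)`: the transport-free first variation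
`H′ = ∫ (∂ₜ + u·∇ − νΔ)‖ω‖² G` on the window `(t₀, (t + T)/2)` (all derivatives of `u` are bounded
on the closed slab `[0, (t + T)/2]` by Tao 2013, Cor. 11.1 and Sobolev imbedding), combined with
the enstrophy density identity `opL_norm_curl_sq_eq`. -/
theorem frequencyCeiling_hasDerivAt {ν T t₀ : ℝ}
    {u : ℝ → EuclideanSpace ℝ (Fin 3) → EuclideanSpace ℝ (Fin 3)}
    {p : ℝ → EuclideanSpace ℝ (Fin 3) → ℝ} {x₀ : EuclideanSpace ℝ (Fin 3)}
    {G : ℝ → EuclideanSpace ℝ (Fin 3) → ℝ} (hν : 0 < ν)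
    (hcl : IsClassicalNSSolutionOn (Ico 0 T) ν 0 u p) (hLH : IsLerayHopfOn T ν 0 (u 0) u)
    (hdec : HasRapidSpatialDecay (u 0)) (ht₀ : t₀ ∈ Ico 0 T)
    (hG : IsAdaptedBackwardKernel ν u (Ico t₀ T) T x₀ G)
    (hcmp : IsGaussianComparable G (Ico t₀ T) T x₀) {t : ℝ} (ht : t ∈ Ioo t₀ T) :
    HasDerivAt (adaptedEnstrophy u G)
      (∫ x, (2 * ⟪curl (u t) x, fderiv ℝ (u t) x (curl (u t) x)⟫ -
        2 * ν * frobeniusNormSq (fderiv ℝ (curl (u t)) x)) * G t x) t := by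
  -- the closed slab `[0, b]`, `b = (t + T)/2`, on which all derivatives of `u` are bounded
  obtain ⟨b, hbdef⟩ : ∃ b : ℝ, b = (t + T) / 2 := ⟨_, rfl⟩
  have htb : t < b := by rw [hbdef]; linarith [ht.2]
  have hbT : b < T := by rw [hbdef]; linarith [ht.2]
  have hb0 : 0 < b := (ht₀.1.trans_lt ht.1).trans htb
  have hcl' : IsClassicalNSSolutionOn (Icc 0 b) ν 0 u p :=
    hcl.mono (Icc_subset_Ico_right hbT) (uniqueDiffOn_Icc hb0)
  have hE : ∃ C : NNReal, ∀ s ∈ Icc 0 b, ∫⁻ x, ‖u s x‖ₑ ^ 2 ≤ C :=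
    ⟨(2 * VectorCalculus.kineticEnergy (u 0)).toNNReal, fun s hs =>
      hLH.lintegral_enorm_sq_le hν.le ⟨hs.1, hs.2.trans hbT.le⟩⟩
  have hH : HasBoundedSobolevNormsOn (Icc 0 b) u :=
    tao2011_hasBoundedSobolevNormsOn_holds hν hb0 hcl' hE hdec
  have hsm := fun s (hs : s ∈ Icc 0 b) => hcl'.contDiff_velocity hs
  obtain ⟨K₀, hK₀⟩ := exists_forall_norm_iteratedFDeriv_le_of_hasBoundedSobolevNormsOn hsm hH 0
  obtain ⟨K₁, hK₁⟩ := exists_forall_norm_iteratedFDeriv_le_of_hasBoundedSobolevNormsOn hsm hH 1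
  obtain ⟨K₂, hK₂⟩ := exists_forall_norm_iteratedFDeriv_le_of_hasBoundedSobolevNormsOn hsm hH 2
  obtain ⟨K₃, hK₃⟩ := exists_forall_norm_iteratedFDeriv_le_of_hasBoundedSobolevNormsOn hsm hH 3
  set K := max (max K₀ K₁) (max K₂ K₃)
  have hIoo : Ioo t₀ b ⊆ Icc 0 b := fun s hs => ⟨ht₀.1.trans hs.1.le, hs.2.le⟩
  have hU : ∀ s ∈ Ioo t₀ b, ∀ x, ‖u s x‖ ≤ K := fun s hs x => by
    have h := hK₀ s (hIoo hs) x
    rw [norm_iteratedFDeriv_zero] at h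
    exact h.trans ((le_max_left _ _).trans (le_max_left _ _))
  have hD : ∀ k : ℕ, 1 ≤ k → k ≤ 3 → ∀ s ∈ Ioo t₀ b, ∀ x, ‖iteratedFDeriv ℝ k (u s) x‖ ≤ K := by
    intro k hk1 hk3 s hs x
    interval_cases k
    · exact (hK₁ s (hIoo hs) x).trans ((le_max_right _ _).trans (le_max_left _ _))
    · exact (hK₂ s (hIoo hs) x).trans ((le_max_left _ _).trans (le_max_right _ _))
    · exact (hK₃ s (hIoo hs) x).trans ((le_max_right _ _).trans (le_max_right _ _))
  have key := kernelCalculus_hasDerivAt_adaptedEnstrophy_of_bounds hcl hG hcmp ht₀.1 le_rfl hbT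
    hU hD ⟨ht.1, htb⟩
  -- the integrand is the spatial expression `2⟪ω, (∇u)ω⟫ − 2ν|∇ω|²_F`
  refine key.congr_deriv (integral_congr_ae (Eventually.of_forall fun x => ?_))
  have htT : t ∈ Ico 0 T := ⟨ht₀.1.trans ht.1.le, ht.2⟩
  have hnhds : Ico 0 T ∈ 𝓝 t := Ico_mem_nhds (ht₀.1.trans_lt ht.1) ht.2
  have h1 := opL_norm_curl_sq_eq hcl (uniqueDiffOn_Ico 0 T) htT x
  simp only [timeDerivWithin_apply] at h1
  rw [derivWithin_of_mem_nhds hnhds] at h1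
  simp only
  rw [h1]

/-- **Pointwise bound on the density**: for `ν ≥ 0`,
`2⟪ω, Aω⟫ − 2ν|B|²_F ≤ 2‖A‖ ‖ω‖²` (Cauchy–Schwarz, the operator norm, and dropping the
nonpositive dissipation term). -/
theorem frequencyCeiling_density_le {ν : ℝ} (hν : 0 ≤ ν) (ω : EuclideanSpace ℝ (Fin 3))
    (A B : EuclideanSpace ℝ (Fin 3) →L[ℝ] EuclideanSpace ℝ (Fin 3)) :
    2 * ⟪ω, A ω⟫ - 2 * ν * frobeniusNormSq B ≤ 2 * ‖A‖ * ‖ω‖ ^ 2 := by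
  have h1 : ⟪ω, A ω⟫ ≤ ‖A‖ * ‖ω‖ ^ 2 := by
    calc ⟪ω, A ω⟫ ≤ ‖ω‖ * ‖A ω‖ := real_inner_le_norm _ _
      _ ≤ ‖ω‖ * (‖A‖ * ‖ω‖) :=
          mul_le_mul_of_nonneg_left (A.le_opNorm ω) (norm_nonneg _)
      _ = ‖A‖ * ‖ω‖ ^ 2 := by ring
  have h2 : 0 ≤ 2 * ν * frobeniusNormSq B :=
    mul_nonneg (mul_nonneg zero_le_two hν) (frobeniusNormSq_nonneg B)
  linarith

/-! ### The stub -/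

/-- **Frequency ceiling** (stub `stub_frequencyCeiling` of line `unsteadiness-squeeze`, crux
`AdaptedFrequencyConverges`): near `T` the adapted frequency
`Λ(t) = (T − t) H′(t)/H(t)` is bounded above. With the floor `0 < c₀ ≤ (T − t)² H(t)`
(`stub_pinchingLower`), the Type-I gradient bound `‖∇u(t)‖_∞ ≤ K/(T − t)`
(`pinchingUpper_fderiv_bound`) and the first variation
`H′(t) = ∫ (2⟪ω, (∇u)ω⟫ − 2ν|∇ω|²_F) G(t) ≤ 2‖∇u(t)‖_∞ H(t)` (`frequencyCeiling_hasDerivAt`),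
`Λ(t) ≤ 2K` on `[max (t₁, T/2, (t₀ + T)/2), T)`. -/
theorem stub_frequencyCeiling :
    ∀ (ν T : ℝ) (u : ℝ → EuclideanSpace ℝ (Fin 3) → EuclideanSpace ℝ (Fin 3)) (p : ℝ → EuclideanSpace ℝ (Fin 3) → ℝ) (x₀ : EuclideanSpace ℝ (Fin 3)) (t₀ : ℝ) (G : ℝ → EuclideanSpace ℝ (Fin 3) → ℝ), 0 < ν → 0 < T → IsClassicalNSSolutionOn (Ico 0 T) ν 0 u p → IsLerayHopfOn T ν 0 (u 0) u → HasRapidSpatialDecay (u 0) → IsTypeIBlowup u T → t₀ ∈ Ico 0 T → (∀ r : ℝ, 0 < r → eLpNorm (Function.uncurry u) ⊤ (volume.restrict (parabolicCylinder r (T, x₀))) = ⊤) → IsAdaptedBackwardKernel ν u (Ico t₀ T) T x₀ G → IsGaussianComparable G (Ico t₀ T) T x₀ → ∃ t₁ ∈ Ico t₀ T, ∃ M : ℝ, ∀ t ∈ Ico t₁ T, adaptedFrequency u G T t ≤ M := by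
  intro ν T u p x₀ t₀ G hν hT hcl hLH hdec hTI ht₀ hsing hG hcmp
  -- (1) the floor `0 < c₀ ≤ (T − t)² H(t)` on `[t₁, T)`
  obtain ⟨t₁, ht₁, c₀, hc₀, hfloor⟩ :=
    stub_pinchingLower ν T u p x₀ t₀ G hν hT hcl hLH hdec hTI ht₀ hsing hG hcmp
  -- (2) the Type-I gradient bound on `[T/2, T)`
  obtain ⟨K, hK0, hK⟩ := pinchingUpper_fderiv_bound hν hT hcl hLH hdec hTI
  -- the final window `[t₂, T)`
  obtain ⟨t₂, ht₂def⟩ : ∃ t₂ : ℝ, t₂ = max (max t₁ (T / 2)) ((t₀ + T) / 2) := ⟨_, rfl⟩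
  have ht₂T : t₂ < T := by
    rw [ht₂def]; exact max_lt (max_lt ht₁.2 (by linarith)) (by linarith [ht₀.2])
  have h12 : t₁ ≤ t₂ := by rw [ht₂def]; exact (le_max_left _ _).trans (le_max_left _ _)
  have hH2 : T / 2 ≤ t₂ := by rw [ht₂def]; exact (le_max_right _ _).trans (le_max_left _ _)
  have h02 : (t₀ + T) / 2 ≤ t₂ := by rw [ht₂def]; exact le_max_right _ _
  refine ⟨t₂, ⟨ht₁.1.trans h12, ht₂T⟩, 2 * K, fun t ht => ?_⟩
  have htT : t < T := ht.2
  have hTt : 0 < T - t := sub_pos.2 htT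
  have ht1 : t ∈ Ico t₁ T := ⟨h12.trans ht.1, htT⟩
  have htH : t ∈ Ico (T / 2) T := ⟨hH2.trans ht.1, htT⟩
  have ht0 : t ∈ Ioo t₀ T := ⟨by linarith [ht.1, ht₀.2], htT⟩
  have htS : t ∈ Ico t₀ T := ⟨ht0.1.le, htT⟩
  have ht0T : t ∈ Ico 0 T := ⟨ht₀.1.trans ht0.1.le, htT⟩
  -- `H(t) > 0`
  have hHpos : 0 < adaptedEnstrophy u G t := by
    have h1 := hfloor t ht1
    by_contra hle
    push Not at hle
    have : (T - t) ^ 2 * adaptedEnstrophy u G t ≤ 0 :=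
      mul_nonpos_of_nonneg_of_nonpos (sq_nonneg _) hle
    linarith
  -- `H′(t) ≤ (2K/(T − t)) H(t)`
  have hd := (frequencyCeiling_hasDerivAt hν hcl hLH hdec ht₀ hG hcmp ht0).deriv
  have hbound : deriv (adaptedEnstrophy u G) t ≤ 2 * (K / (T - t)) * adaptedEnstrophy u G t := by
    rw [hd, adaptedEnstrophy_apply, ← integral_const_mul]
    have hGi : Integrable (G t) := hG.integrable htS
    have hGp : ∀ x, 0 < G t x := hG.pos t htS
    have hu1 : ContDiff ℝ 1 (u t) := contDiff_infty.1 (hcl.contDiff_velocity ht0T) 1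
    have hωc : Continuous fun x => ‖curl (u t) x‖ ^ 2 := ((continuous_curl hu1).norm).pow 2
    have hωb : ∀ x, ‖curl (u t) x‖ ^ 2 ≤ (4 * (K / (T - t))) ^ 2 := fun x =>
      pow_le_pow_left₀ (norm_nonneg _)
        ((norm_curl_le_four_mul (u t) x).trans (by gcongr; exact hK t htH x)) 2
    have hg : Integrable (fun x => 2 * (K / (T - t)) * (‖curl (u t) x‖ ^ 2 * G t x)) := by
      refine (hGi.bdd_mul hωc.aestronglyMeasurable (c := (4 * (K / (T - t))) ^ 2)
        (Eventually.of_forall fun x => ?_)).const_mul _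
      rw [Real.norm_eq_abs, abs_of_nonneg (sq_nonneg _)]
      exact hωb x
    have hle : ∀ x, (2 * ⟪curl (u t) x, fderiv ℝ (u t) x (curl (u t) x)⟫ -
        2 * ν * frobeniusNormSq (fderiv ℝ (curl (u t)) x)) * G t x ≤
        2 * (K / (T - t)) * (‖curl (u t) x‖ ^ 2 * G t x) := fun x => by
      have h1 := frequencyCeiling_density_le hν.le (curl (u t) x) (fderiv ℝ (u t) x)
        (fderiv ℝ (curl (u t)) x)
      have h2 : 2 * ‖fderiv ℝ (u t) x‖ * ‖curl (u t) x‖ ^ 2 ≤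
          2 * (K / (T - t)) * ‖curl (u t) x‖ ^ 2 := by
        gcongr; exact hK t htH x
      calc (2 * ⟪curl (u t) x, fderiv ℝ (u t) x (curl (u t) x)⟫ -
            2 * ν * frobeniusNormSq (fderiv ℝ (curl (u t)) x)) * G t x
          ≤ (2 * (K / (T - t)) * ‖curl (u t) x‖ ^ 2) * G t x :=
            mul_le_mul_of_nonneg_right (h1.trans h2) (hGp x).le
        _ = 2 * (K / (T - t)) * (‖curl (u t) x‖ ^ 2 * G t x) := by ring
    have hgnn : ∀ x, 0 ≤ 2 * (K / (T - t)) * (‖curl (u t) x‖ ^ 2 * G t x) := fun x =>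
      mul_nonneg (by positivity) (mul_nonneg (sq_nonneg _) (hGp x).le)
    by_cases hf : Integrable (fun x => (2 * ⟪curl (u t) x, fderiv ℝ (u t) x (curl (u t) x)⟫ -
        2 * ν * frobeniusNormSq (fderiv ℝ (curl (u t)) x)) * G t x)
    · exact integral_mono hf hg hle
    · rw [integral_undef hf]; exact integral_nonneg hgnn
  -- conclusion: `Λ(t) = (T − t) H′(t)/H(t) ≤ 2K`
  rw [adaptedFrequency_apply, div_le_iff₀ hHpos]
  have hne : T - t ≠ 0 := hTt.ne'
  calc (T - t) * deriv (adaptedEnstrophy u G) t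
      ≤ (T - t) * (2 * (K / (T - t)) * adaptedEnstrophy u G t) :=
        mul_le_mul_of_nonneg_left hbound hTt.le
    _ = 2 * K * adaptedEnstrophy u G t := by field_simp

end Summit.NavierStokesRegularity.NavierStokesRegularity.Theorems.AdaptedFrequencyConverges.UnsteadinessSqueeze

end
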